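import Mathlib
import Literature.NumberTheory.LFunctions.Zhang2022.Section15CLemma153RpGlue
import Literature.NumberTheory.LFunctions.Zhang2022.Section15CCalU1REuler
import Literature.NumberTheory.LFunctions.Zhang2022.Section15Eq1523Edge
import HarnessLib

/-!
# Zhang (2022), §15 Lemma 15.3 (repaired normaliser): the continuation of `𝒰₁ⱼ` NEAR `s = 1` —
# `‖U(s)‖ ≤ C·𝓛` on `‖s − 1‖ ≤ 1/𝓛`, from the local Euler factors (glue)

Topic `Literature/NumberTheory/LFunctions/Zhang2022` (Landau–Siegel audit tree; verdict-neutral).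
Y. Zhang, *Discrete mean estimates and the Landau–Siegel zero*, arXiv:2211.02515v1 (2022)
[Zhang2022LandauSiegel], §15 Lemma 15.3 p. 87 and its Appendix-A sketch p. 105, **an unrefereed
manuscript under adjudication; nothing here asserts or denies its Theorems 1–2.** Lane ZHANG-L (WP15,
ruling R-34 / RT-07 amended): the amended u055 node `Typed.Section15C.Step15_u055RelS` is consumed
(`Ded1524.u056_rate1_of_partsRelS`, file `Section15U056RateRelS`) together with a NEAR-`1` bound on the
continuation `U` of the repaired `𝒰₁ⱼ` (`calU1R`): `‖U(s)‖ ≤ C₇𝓛` for `‖s−1‖ ≤ 1/𝓛`. This file PROVES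
that bound from the same local hypothesis as the half-plane glue
`Section15C.lemma153Rp_part1_of_local` (per-prime holomorphy on `σ > 17/20` and the repaired local
estimate `‖𝔲ᴿ₁ⱼ(q,s) − 1‖ ≤ C(q^{−2σ} + q^{−1−σ})` for `q ∤ D`), the Euler identity `StepA_u030R` being a
theorem (`Typed.AppendixA2.stepA_u030R_holds`):

* `calU1R_near_one_of_local` — `∃ C₇, ForAllLarge, (A) → ∀ j ∈ {1,2,3}, ∃ U, IsCalU1R … U ∧
  ∀ s, ‖s − 1‖ ≤ 1/𝓛 → ‖U s‖ ≤ C₇·𝓛`.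

Mechanism (App. A p. 105 with the near-`1` sizes): `U = ∏'_q 𝔲ᴿ₁ⱼ(q,·)`; for `q ∤ D` the factors
multiply to `≤ exp(2C·Σ_q q^{−17/10})`; for `q ∣ D` the factor is `(1 − q^{−s})²` (`ϖ₁ⱼ(1) = 1`) and,
for `‖s−1‖ ≤ 1/𝓛`, `|q^{−s}| = q^{−σ} ≤ q^{1/𝓛}/q ≤ e/q` (`q ≤ D`), so `∏_{q∣D}|1 − q^{−s}|² ≤
∏_{q∣D}(1 + 3/q)² ≤ (D/φ(D))⁶ ≤ (2 log 𝓛)⁶ ≤ 𝓛` for all large `D` (Landau's `D/φ(D) ≤ 2 log log D`,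
tree `Ded1524.self_div_totient_le_two_mul_loglog`). Theorems only; no definition, no fact.
WHAT THIS IS NOT: a proof of the local hypothesis, or of anything about Theorems 1–2 / Landau–Siegel zeros.

## References

* Y. Zhang, arXiv:2211.02515v1 (2022), §15 Lemma 15.3 p. 87; App. A p. 105 (tex L5172–L5185).
  [cite: Zhang2022LandauSiegel, §15 Lemma 15.3]
* G. H. Hardy, E. M. Wright, *An Introduction to the Theory of Numbers*, Thm 328. [cite: HardyWright2008, Thm 328]
-/

noncomputable section

open Complex Real Filter Topology Finset

namespace Literature.NumberTheory.LFunctions.Zhang2022.Typed.Section15C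

open Literature.NumberTheory.LFunctions.Zhang2022
open Literature.NumberTheory.LFunctions.Zhang2022.Skeleton
open Literature.NumberTheory.LFunctions.Zhang2022.Typed.Section15B
open Literature.NumberTheory.LFunctions.Zhang2022.Typed.AppendixA2

/-! ## Real-analysis and arithmetic helpers -/

/-- Products of reals over a sub-finset: factors `≥ 0` on `s` and `≥ 1` on `t ∖ s` give `∏_s f ≤ ∏_t f`.
[folklore] -/
private theorem prod_le_prod_of_subset_real' {ι : Type*} [DecidableEq ι] {s t : Finset ι} (f : ι → ℝ)
    (hst : s ⊆ t) (hs : ∀ i ∈ s, 0 ≤ f i) (ht : ∀ i ∈ t, i ∉ s → 1 ≤ f i) :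
    ∏ i ∈ s, f i ≤ ∏ i ∈ t, f i := by
  rw [← Finset.prod_sdiff hst]
  have h1 : (1 : ℝ) ≤ ∏ i ∈ t \ s, f i := by
    rw [← Finset.prod_const_one (s := t \ s)]
    refine Finset.prod_le_prod (fun _ _ => zero_le_one) fun i hi => ?_
    exact ht i (Finset.mem_sdiff.mp hi).1 (Finset.mem_sdiff.mp hi).2
  have h0 : 0 ≤ ∏ i ∈ s, f i := Finset.prod_nonneg hs
  exact le_mul_of_one_le_left h0 h1

/-- `∏_{i∈A}(1 + x_i) ≤ exp(Σ_{i∈A} x_i)` for `x_i ≥ 0`. [folklore] -/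
private theorem prod_one_add_le_exp_sum' {ι : Type*} (A : Finset ι) (x : ι → ℝ)
    (hx : ∀ i ∈ A, 0 ≤ x i) : ∏ i ∈ A, (1 + x i) ≤ Real.exp (∑ i ∈ A, x i) := by
  rw [Real.exp_sum]
  exact Finset.prod_le_prod (fun i hi => by linarith [hx i hi]) fun i _ => by
    linarith [Real.add_one_le_exp (x i)]

/-- `∏_{q∣n}(1 + 1/q) ≤ n/φ(n)` (`n ≥ 1`). [folklore] -/
private theorem prod_primeFactors_one_add_inv_le_self_div_totient' {n : ℕ} (hn : n ≠ 0) :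
    ∏ q ∈ n.primeFactors, (1 + (q : ℝ)⁻¹) ≤ (n : ℝ) / Nat.totient n := by
  have hφ : (0 : ℝ) < Nat.totient n := by exact_mod_cast Nat.totient_pos.mpr (Nat.pos_of_ne_zero hn)
  have key := Nat.totient_mul_prod_primeFactors n
  have hcast : (Nat.totient n : ℝ) * ∏ q ∈ n.primeFactors, (q : ℝ) =
      (n : ℝ) * ∏ q ∈ n.primeFactors, ((q : ℝ) - 1) := by
    have h := congrArg (fun m : ℕ => (m : ℝ)) key
    simp only [Nat.cast_mul, Nat.cast_prod] at h
    rw [h]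
    congr 1
    refine Finset.prod_congr rfl fun q hq => ?_
    rw [Nat.cast_sub (Nat.prime_of_mem_primeFactors hq).one_lt.le, Nat.cast_one]
  have hP1 : 0 < ∏ q ∈ n.primeFactors, ((q : ℝ) - 1) :=
    Finset.prod_pos fun q hq => by
      have h2 : (2 : ℝ) ≤ q := by exact_mod_cast (Nat.prime_of_mem_primeFactors hq).two_le
      linarith
  have hterm : (∏ q ∈ n.primeFactors, (1 + (q : ℝ)⁻¹)) * ∏ q ∈ n.primeFactors, ((q : ℝ) - 1) ≤
      ∏ q ∈ n.primeFactors, (q : ℝ) := by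
    rw [← Finset.prod_mul_distrib]
    refine Finset.prod_le_prod (fun q hq => ?_) fun q hq => ?_
    · have h2 : (2 : ℝ) ≤ q := by exact_mod_cast (Nat.prime_of_mem_primeFactors hq).two_le
      have : 0 ≤ (q : ℝ)⁻¹ := by positivity
      nlinarith
    · have h2 : (2 : ℝ) ≤ q := by exact_mod_cast (Nat.prime_of_mem_primeFactors hq).two_le
      have hq0 : (0 : ℝ) < q := by linarith
      have e : (1 + (q : ℝ)⁻¹) * ((q : ℝ) - 1) = q - (q : ℝ)⁻¹ := by field_simp; ring
      rw [e]
      have : 0 ≤ (q : ℝ)⁻¹ := by positivity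
      linarith
  rw [le_div_iff₀ hφ]
  calc (∏ q ∈ n.primeFactors, (1 + (q : ℝ)⁻¹)) * Nat.totient n
      = ((Nat.totient n : ℝ) * ((∏ q ∈ n.primeFactors, (1 + (q : ℝ)⁻¹)) *
          ∏ q ∈ n.primeFactors, ((q : ℝ) - 1))) / ∏ q ∈ n.primeFactors, ((q : ℝ) - 1) := by
        field_simp
    _ ≤ ((Nat.totient n : ℝ) * ∏ q ∈ n.primeFactors, (q : ℝ)) /
          ∏ q ∈ n.primeFactors, ((q : ℝ) - 1) := by gcongr
    _ = (n : ℝ) := by rw [hcast, mul_div_assoc, div_self hP1.ne', mul_one]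

/-- **`∏_{q∣n}(1 + c/q) ≤ (n/φ(n))^c`** for a natural number `c` (`n ≥ 1`): Bernoulli
`1 + c/q ≤ (1 + 1/q)^c`. [folklore] -/
private theorem prod_primeFactors_one_add_div_le_pow' {n : ℕ} (hn : n ≠ 0) (c : ℕ) :
    ∏ q ∈ n.primeFactors, (1 + (c : ℝ) / q) ≤ ((n : ℝ) / Nat.totient n) ^ c := by
  have h1 : ∏ q ∈ n.primeFactors, (1 + (c : ℝ) / q) ≤ ∏ q ∈ n.primeFactors, (1 + (q : ℝ)⁻¹) ^ c := by
    refine Finset.prod_le_prod (fun q _ => by positivity) fun q _ => ?_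
    have hq : (-2 : ℝ) ≤ (q : ℝ)⁻¹ := by
      have : (0 : ℝ) ≤ (q : ℝ)⁻¹ := by positivity
      linarith
    have h := one_add_mul_le_pow hq c
    rw [div_eq_mul_inv]
    exact h
  rw [Finset.prod_pow] at h1
  exact h1.trans (pow_le_pow_left₀ (Finset.prod_nonneg fun q _ => by positivity)
    (prod_primeFactors_one_add_inv_le_self_div_totient' hn) c)

/-- **The factor at a prime `q ∣ D` near `s = 1`**: for `q ≤ D` prime, `D ≥ 3`, and
`‖s − 1‖ ≤ 1/log D`: `‖(1 − q^{−s})²‖ ≤ (1 + 3/q)²` (`q^{−σ} ≤ q^{1/log D}/q ≤ e/q`).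
[cite: Zhang2022LandauSiegel, §15 Lemma 15.3 p. 87] -/
theorem norm_one_sub_cpow_sq_le_near_one {D q : ℕ} (hD : 3 ≤ D) (hq : q.Prime) (hqD : q ≤ D)
    {s : ℂ} (hs : ‖s - 1‖ ≤ 1 / Real.log D) :
    ‖(1 - (q : ℂ) ^ (-s)) ^ 2‖ ≤ (1 + 3 / (q : ℝ)) ^ 2 := by
  have hD0 : (0 : ℝ) < D := by exact_mod_cast (show 0 < D by omega)
  have hD3 : (3 : ℝ) ≤ D := by exact_mod_cast hD
  have hlogD : 0 < Real.log D := Real.log_pos (by linarith)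
  have hq0 : (0 : ℝ) < q := by exact_mod_cast hq.pos
  have hq1 : (1 : ℝ) ≤ q := by exact_mod_cast hq.one_lt.le
  have hqD' : (q : ℝ) ≤ D := by exact_mod_cast hqD
  -- `σ ≥ 1 − 1/log D`
  have hσ : 1 - 1 / Real.log D ≤ s.re := by
    have h1 : |(s - 1).re| ≤ ‖s - 1‖ := Complex.abs_re_le_norm _
    rw [Complex.sub_re, Complex.one_re] at h1
    have := (abs_le.mp (h1.trans hs)).1
    linarith
  -- `‖q^{−s}‖ = q^{−σ} ≤ q^{1/log D − 1} = q^{1/log D}/q ≤ e/q ≤ 3/q`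
  have hn : ‖(q : ℂ) ^ (-s)‖ ≤ 3 / (q : ℝ) := by
    rw [Complex.norm_natCast_cpow_of_pos hq.pos, Complex.neg_re]
    have h1 : (q : ℝ) ^ (-s.re) ≤ (q : ℝ) ^ (1 / Real.log D - 1) :=
      Real.rpow_le_rpow_of_exponent_le hq1 (by linarith)
    have h2 : (q : ℝ) ^ (1 / Real.log D - 1) = (q : ℝ) ^ (1 / Real.log D) / q := by
      rw [Real.rpow_sub hq0, Real.rpow_one]
    have h3 : (q : ℝ) ^ (1 / Real.log D) ≤ (D : ℝ) ^ (1 / Real.log D) :=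
      Real.rpow_le_rpow hq0.le hqD' (by positivity)
    have h4 : (D : ℝ) ^ (1 / Real.log D) = Real.exp 1 := by
      rw [Real.rpow_def_of_pos hD0, one_div, mul_inv_cancel₀ hlogD.ne']
    have h5 : Real.exp 1 ≤ 3 := by have := Real.exp_one_lt_d9; linarith
    calc (q : ℝ) ^ (-s.re) ≤ (q : ℝ) ^ (1 / Real.log D) / q := h1.trans h2.le
      _ ≤ Real.exp 1 / q := by rw [← h4]; exact div_le_div_of_nonneg_right h3 hq0.le
      _ ≤ 3 / q := div_le_div_of_nonneg_right h5 hq0.le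
  rw [norm_pow]
  refine pow_le_pow_left₀ (norm_nonneg _) ?_ 2
  calc ‖1 - (q : ℂ) ^ (-s)‖ ≤ ‖(1 : ℂ)‖ + ‖(q : ℂ) ^ (-s)‖ := norm_sub_le _ _
    _ ≤ 1 + 3 / (q : ℝ) := by rw [norm_one]; exact add_le_add le_rfl hn

/-- `(2 log 𝓛)⁶ ≤ 𝓛` and `𝓛 ≥ 10` for all large `D` (`𝓛 = log D`). [folklore] -/
private theorem eventually_loglog_pow_six_le :
    ∃ N : ℕ, ∀ D : ℕ, N ≤ D → (2 * Real.log (ell D)) ^ 6 ≤ ell D ∧ 10 ≤ ell D := by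
  have hℓ : Tendsto (fun D : ℕ => ell D) atTop atTop :=
    Real.tendsto_log_atTop.comp tendsto_natCast_atTop_atTop
  have h1 : Tendsto (fun x : ℝ => Real.log x ^ 6 / (1 * x + 0)) atTop (𝓝 0) :=
    Real.tendsto_pow_log_div_mul_add_atTop 1 0 6 one_ne_zero
  have h2 : ∀ᶠ D : ℕ in atTop, Real.log (ell D) ^ 6 / (1 * ell D + 0) ≤ 1 / 64 :=
    (h1.comp hℓ).eventually (eventually_le_nhds (by norm_num))
  have h3 : ∀ᶠ D : ℕ in atTop, 10 ≤ ell D := hℓ.eventually (eventually_ge_atTop 10)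
  obtain ⟨N, hN⟩ := Filter.eventually_atTop.mp (h2.and h3)
  refine ⟨N, fun D hD => ?_⟩
  obtain ⟨ha, hb⟩ := hN D hD
  have hℓ0 : 0 < ell D := by linarith
  rw [one_mul, add_zero, div_le_iff₀ hℓ0] at ha
  refine ⟨?_, hb⟩
  calc (2 * Real.log (ell D)) ^ 6 = 64 * Real.log (ell D) ^ 6 := by ring
    _ ≤ 64 * (1 / 64 * ell D) := by gcongr
    _ = ell D := by ring

/-! ## The near-`1` glue -/

/-- **Lemma 15.3 (repaired normaliser), the continuation NEAR `s = 1` — from the local Euler factors.**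
HYPOTHESIS (H) (the same as in `lemma153Rp_part1_of_local`): for all large `D`, under (A), for
`1 ≤ j ≤ 3` and every prime `q`, `s ↦ 𝔲ᴿ₁ⱼ(q,s)` (`frakU1FactorR`) is holomorphic on `σ > 17/20` and,
for `q ∤ D`, `‖𝔲ᴿ₁ⱼ(q,s) − 1‖ ≤ C(q^{−2σ} + q^{−1−σ})` there. CONCLUSION: there is `C₇` such that for all
large `D`, under (A), for `1 ≤ j ≤ 3`, some analytic continuation `U` of `calU1R` to `Re s ≥ 9/10`
(`IsCalU1R`) satisfies `‖U(s)‖ ≤ C₇·𝓛` whenever `‖s − 1‖ ≤ 1/𝓛` (`𝓛 = log D`). This is the `hnear`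
input of `Ded1524.u056_rate1_of_partsRelS`; the continuation is `∏'_q 𝔲ᴿ₁ⱼ(q,·)` as in the
half-plane glue (the Euler identity on `σ > 1` is `Typed.AppendixA2.stepA_u030R_holds`), and any two
continuations agree (`isCalU1R_eqOn`). [cite: Zhang2022LandauSiegel, §15 Lemma 15.3 p. 87] -/
theorem calU1R_near_one_of_local (c' : ℝ)
    (hloc : ∃ C : ℝ, ForAllLarge fun D _ χ => AssumptionA D χ → ∀ j ∈ ({1, 2, 3} : Finset ℕ),
      ∀ q : ℕ, q.Prime →
        DifferentiableOn ℂ (fun s => frakU1FactorR c' χ j q s) {s : ℂ | 17 / 20 < s.re} ∧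
          (¬ q ∣ D → ∀ s : ℂ, 17 / 20 < s.re →
            ‖frakU1FactorR c' χ j q s - 1‖ ≤
              C * ((q : ℝ) ^ (-(2 * s.re)) + (q : ℝ) ^ (-(1 + s.re))))) :
    ∃ C₇ : ℝ, ForAllLarge fun D _ χ => AssumptionA D χ → ∀ j ∈ ({1, 2, 3} : Finset ℕ),
      ∃ U : ℂ → ℂ, IsCalU1R c' inputs15AB χ j U ∧
        ∀ s : ℂ, ‖s - 1‖ ≤ 1 / ell D → ‖U s‖ ≤ C₇ * ell D := by
  classical
  obtain ⟨C, hloc⟩ := hloc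
  -- constants
  set C' : ℝ := max C 0 with hC'def
  have hC'0 : 0 ≤ C' := le_max_right _ _
  have hZsum : Summable fun n : ℕ => (n : ℝ) ^ (-(17 / 10 : ℝ)) :=
    Real.summable_nat_rpow.mpr (by norm_num)
  set Z : ℝ := ∑' n : ℕ, (n : ℝ) ^ (-(17 / 10 : ℝ)) with hZdef
  have hZ0 : 0 ≤ Z := tsum_nonneg fun n => Real.rpow_nonneg (Nat.cast_nonneg n) _
  set Cfin : ℝ := Real.exp (2 * C' * Z) with hCfindef
  have hCfin1 : 1 ≤ Cfin := Real.one_le_exp (by positivity)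
  -- thresholds: the local inputs, `ϖ₁ⱼ(1) = 1`, the Euler identity, `D/φ(D) ≤ 2 log 𝓛`, `(2 log 𝓛)⁶ ≤ 𝓛`
  obtain ⟨D₁, hD₁⟩ := Ded1524.self_div_totient_le_two_mul_loglog
  obtain ⟨N, hN⟩ := eventually_loglog_pow_six_le
  have hT : ForAllLarge fun D _ _ =>
      ((D : ℝ) / Nat.totient D ≤ 2 * Real.log (ell D)) ∧
        ((2 * Real.log (ell D)) ^ 6 ≤ ell D ∧ 10 ≤ ell D) :=
    ForAllLarge.of_le (max D₁ N) fun D _ _ hD _ _ =>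
      ⟨hD₁ D (le_trans (le_max_left _ _) hD), hN D (le_trans (le_max_right _ _) hD)⟩
  refine ⟨Cfin, ((hloc.and (inline15_varpiMult_holds c')).and (stepA_u030R_holds c')).and hT
    |>.mono fun D _ χ _ _ hS hA j hj => ?_⟩
  obtain ⟨⟨⟨hlocD, hmult⟩, h30D⟩, ⟨hφ, hpow6, hℓ10⟩⟩ := hS
  have hv1 : varpi1 c' χ j 1 = 1 := (hmult hA j hj).1
  have h30j := h30D hA j hj
  have hDpos : 0 < D := Nat.pos_of_ne_zero (NeZero.ne D)
  have hℓ0 : 0 < ell D := by linarith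
  have hD3 : 3 ≤ D := by
    by_contra hlt
    have : (D : ℝ) < 3 := by exact_mod_cast not_le.mp hlt
    have hD0 : 0 < (D : ℝ) := by exact_mod_cast hDpos
    have : ell D < 3 := by
      calc ell D = Real.log D := rfl
        _ < Real.log (Real.exp 3) := Real.log_lt_log hD0 (by
            have := Real.add_one_le_exp (3:ℝ); linarith)
        _ = 3 := Real.log_exp 3
    linarith
  -- the factors and the open half-plane
  set O : Set ℂ := {s : ℂ | 17 / 20 < s.re} with hOdef
  have hO : IsOpen O := isOpen_lt continuous_const Complex.continuous_re
  set F : Nat.Primes → ℂ → ℂ := fun q s => frakU1FactorR c' χ j (q : ℕ) s with hFdef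
  have hFdvd : ∀ q : Nat.Primes, (q : ℕ) ∣ D → ∀ s : ℂ, F q s = (1 - ((q : ℕ) : ℂ) ^ (-s)) ^ 2 :=
    fun q hqD s => frakU1FactorR_eq_of_dvd_of_varpi1_one c' χ j q.prop hqD hv1 s
  -- the majorant for the `M`-test
  set b : Nat.Primes → ℝ := fun q =>
    2 * C' * ((q : ℕ) : ℝ) ^ (-(17 / 10 : ℝ)) + (if (q : ℕ) ∣ D then 3 else 0) with hbdef
  have hb1sum : Summable fun q : Nat.Primes => 2 * C' * ((q : ℕ) : ℝ) ^ (-(17 / 10 : ℝ)) :=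
    (hZsum.comp_injective Subtype.val_injective).mul_left _
  set S₂ : Finset Nat.Primes := D.primeFactors.subtype Nat.Prime with hS₂def
  have hb2sum : Summable fun q : Nat.Primes => (if (q : ℕ) ∣ D then (3 : ℝ) else 0) := by
    refine summable_of_ne_finset_zero (s := S₂) fun q hq' => ?_
    have hndvd : ¬ (q : ℕ) ∣ D := fun h' =>
      hq' (Finset.mem_subtype.mpr (Nat.mem_primeFactors.mpr ⟨q.prop, h', hDpos.ne'⟩))
    rw [if_neg hndvd]
  have hbsum : Summable b := hb1sum.add hb2sum
  -- the per-prime bounds on `O`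
  have hcop : ∀ q : Nat.Primes, ¬ (q : ℕ) ∣ D → ∀ s ∈ O,
      ‖F q s - 1‖ ≤ 2 * C' * ((q : ℕ) : ℝ) ^ (-(17 / 10 : ℝ)) := by
    intro q hqD s hs
    have hs' : 17 / 20 < s.re := hs
    have hqp : (q : ℕ).Prime := q.prop
    have hq1 : (1 : ℝ) ≤ ((q : ℕ) : ℝ) := by exact_mod_cast hqp.one_lt.le
    have h := (hlocD hA j hj q hqp).2 hqD s hs'
    have e1 : ((q : ℕ) : ℝ) ^ (-(2 * s.re)) ≤ ((q : ℕ) : ℝ) ^ (-(17 / 10 : ℝ)) :=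
      Real.rpow_le_rpow_of_exponent_le hq1 (by linarith)
    have e2 : ((q : ℕ) : ℝ) ^ (-(1 + s.re)) ≤ ((q : ℕ) : ℝ) ^ (-(17 / 10 : ℝ)) :=
      Real.rpow_le_rpow_of_exponent_le hq1 (by linarith)
    have hsum0 : 0 ≤ ((q : ℕ) : ℝ) ^ (-(2 * s.re)) + ((q : ℕ) : ℝ) ^ (-(1 + s.re)) := by positivity
    calc ‖frakU1FactorR c' χ j q s - 1‖
        ≤ C * (((q : ℕ) : ℝ) ^ (-(2 * s.re)) + ((q : ℕ) : ℝ) ^ (-(1 + s.re))) := h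
      _ ≤ C' * (((q : ℕ) : ℝ) ^ (-(2 * s.re)) + ((q : ℕ) : ℝ) ^ (-(1 + s.re))) :=
          mul_le_mul_of_nonneg_right (le_max_left _ _) hsum0
      _ ≤ C' * (((q : ℕ) : ℝ) ^ (-(17 / 10 : ℝ)) + ((q : ℕ) : ℝ) ^ (-(17 / 10 : ℝ))) := by
          gcongr
      _ = 2 * C' * ((q : ℕ) : ℝ) ^ (-(17 / 10 : ℝ)) := by ring
  have hFb : ∀ q : Nat.Primes, ∀ s ∈ O, ‖F q s - 1‖ ≤ b q := by
    intro q s hs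
    have hs' : 17 / 20 < s.re := hs
    have hnn : 0 ≤ 2 * C' * ((q : ℕ) : ℝ) ^ (-(17 / 10 : ℝ)) := by positivity
    by_cases hqD : (q : ℕ) ∣ D
    · -- `‖(1 − q^{−s})² − 1‖ ≤ 3` for `σ ≥ 0`
      have hq1 : (1 : ℝ) ≤ ((q : ℕ) : ℝ) := by exact_mod_cast q.prop.one_lt.le
      have hX : ‖((q : ℕ) : ℂ) ^ (-s)‖ ≤ 1 := by
        rw [Complex.norm_natCast_cpow_of_pos q.prop.pos, Complex.neg_re]
        exact Real.rpow_le_one_of_one_le_of_nonpos hq1 (by linarith)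
      have h3 : ‖(1 - ((q : ℕ) : ℂ) ^ (-s)) ^ 2 - 1‖ ≤ 3 := by
        have e : (1 - ((q : ℕ) : ℂ) ^ (-s)) ^ 2 - 1 =
            ((q : ℕ) : ℂ) ^ (-s) * (((q : ℕ) : ℂ) ^ (-s) - 2) := by ring
        rw [e, norm_mul]
        calc ‖((q : ℕ) : ℂ) ^ (-s)‖ * ‖((q : ℕ) : ℂ) ^ (-s) - 2‖
            ≤ 1 * (‖((q : ℕ) : ℂ) ^ (-s)‖ + ‖(2 : ℂ)‖) :=
              mul_le_mul hX (norm_sub_le _ _) (norm_nonneg _) zero_le_one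
          _ ≤ 1 * (1 + 2) := by
              gcongr
              rw [Complex.norm_two]
          _ = 3 := by norm_num
      rw [hFdvd q hqD s]
      simp only [hbdef, if_pos hqD]
      linarith
    · simp only [hbdef, if_neg hqD, add_zero]
      exact hcop q hqD s hs
  -- holomorphy of each factor and of the product on `O`
  have hFdiff : ∀ q : Nat.Primes, DifferentiableOn ℂ (F q) O :=
    fun q => (hlocD hA j hj q q.prop).1
  have hUdiff : DifferentiableOn ℂ (fun s => ∏' q : Nat.Primes, F q s) O :=
    Literature.Analysis.Complex.differentiableOn_tprod_of_norm_sub_one_le hO hFdiff hbsum hFb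
  set U : ℂ → ℂ := fun s => ∏' q : Nat.Primes, F q s with hUdef
  refine ⟨U, ⟨?_, ?_⟩, ?_⟩
  · -- analytic on `Re s ≥ 9/10 ⊆ O`
    have hsub : {s : ℂ | 9 / 10 ≤ s.re} ⊆ O := fun s hs => by
      have : 9 / 10 ≤ s.re := hs
      show 17 / 20 < s.re; linarith
    exact (hUdiff.analyticOnNhd hO).mono hsub
  · -- agreement with `calU1R` on `σ > 1`
    intro s hs
    have h := h30j s hs
    show (∏' q : Nat.Primes, frakU1FactorR c' χ j (q : ℕ) s) = Section15C.calU1R c' inputs15AB χ j s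
    exact h.symm
  · -- the bound on the disc `‖s − 1‖ ≤ 1/𝓛`
    intro s hs
    have hσ : 1 - 1 / ell D ≤ s.re := by
      have h1 : |(s - 1).re| ≤ ‖s - 1‖ := Complex.abs_re_le_norm _
      rw [Complex.sub_re, Complex.one_re] at h1
      have := (abs_le.mp (h1.trans hs)).1
      linarith
    have hinv : 1 / ell D ≤ 1 / 10 := one_div_le_one_div_of_le (by norm_num) hℓ10
    have hsO : s ∈ O := by show 17 / 20 < s.re; linarith
    -- the bound `B = Cfin·(D/φ(D))⁶` on every finite partial product
    have hφ1 : (1 : ℝ) ≤ (D : ℝ) / Nat.totient D := by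
      rw [le_div_iff₀ (by exact_mod_cast Nat.totient_pos.mpr hDpos)]
      simpa using (show (Nat.totient D : ℝ) ≤ D by exact_mod_cast Nat.totient_le D)
    have hB1 : 1 ≤ Cfin * ((D : ℝ) / Nat.totient D) ^ 6 := by
      calc (1 : ℝ) = 1 * 1 := (mul_one _).symm
        _ ≤ Cfin * ((D : ℝ) / Nat.totient D) ^ 6 :=
            mul_le_mul hCfin1 (one_le_pow₀ hφ1) zero_le_one (by positivity)
    have hUB : ‖U s‖ ≤ Cfin * ((D : ℝ) / Nat.totient D) ^ 6 := by
      refine Literature.Analysis.Complex.norm_tprod_le_of_forall_norm_prod_le (fun q => F q s) hB1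
        fun A => ?_
      rw [Complex.norm_prod,
        ← Finset.prod_filter_mul_prod_filter_not A (fun q : Nat.Primes => (q : ℕ) ∣ D)]
      -- the `q ∣ D` part: `≤ ∏_{q∣D}(1 + 3/q)² ≤ (D/φ(D))⁶`
      have hdvd_part : ∏ q ∈ A.filter (fun q : Nat.Primes => (q : ℕ) ∣ D), ‖F q s‖ ≤
          ((D : ℝ) / Nat.totient D) ^ 6 := by
        have h1 : ∏ q ∈ A.filter (fun q : Nat.Primes => (q : ℕ) ∣ D), ‖F q s‖ ≤
            ∏ q ∈ A.filter (fun q : Nat.Primes => (q : ℕ) ∣ D), (1 + 3 / ((q : ℕ) : ℝ)) ^ 2 := by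
          refine Finset.prod_le_prod (fun _ _ => norm_nonneg _) fun q hq => ?_
          have hqD : (q : ℕ) ∣ D := (Finset.mem_filter.mp hq).2
          rw [hFdvd q hqD s]
          exact norm_one_sub_cpow_sq_le_near_one hD3 q.prop (Nat.le_of_dvd hDpos hqD)
            (by rw [ell] at hs; exact hs)
        set g : ℕ → ℝ := fun n => (1 + 3 / (n : ℝ)) ^ 2 with hgdef
        have h2 : ∏ q ∈ A.filter (fun q : Nat.Primes => (q : ℕ) ∣ D), (1 + 3 / ((q : ℕ) : ℝ)) ^ 2 =
            ∏ n ∈ (A.filter (fun q : Nat.Primes => (q : ℕ) ∣ D)).map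
              (Function.Embedding.subtype _), g n := by
          rw [Finset.prod_map]
          rfl
        have hsubset : (A.filter (fun q : Nat.Primes => (q : ℕ) ∣ D)).map
            (Function.Embedding.subtype _) ⊆ D.primeFactors := by
          intro n hn
          obtain ⟨q, hq, rfl⟩ := Finset.mem_map.mp hn
          have hqD : (q : ℕ) ∣ D := (Finset.mem_filter.mp hq).2
          exact Nat.mem_primeFactors.mpr ⟨q.prop, hqD, hDpos.ne'⟩
        have h3 : ∏ n ∈ (A.filter (fun q : Nat.Primes => (q : ℕ) ∣ D)).map
              (Function.Embedding.subtype _), g n ≤ ∏ n ∈ D.primeFactors, g n :=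
          prod_le_prod_of_subset_real' g hsubset (fun n _ => by positivity) (fun n _ _ => by
            simp only [hgdef]
            have : 0 ≤ 3 / (n : ℝ) := by positivity
            nlinarith)
        have h4 : ∏ n ∈ D.primeFactors, g n ≤ ((D : ℝ) / Nat.totient D) ^ 6 := by
          have h5 := prod_primeFactors_one_add_div_le_pow' hDpos.ne' 3
          have h6 : ∏ n ∈ D.primeFactors, g n =
              (∏ n ∈ D.primeFactors, (1 + ((3 : ℕ) : ℝ) / n)) ^ 2 := by
            rw [← Finset.prod_pow]
            refine Finset.prod_congr rfl fun n _ => ?_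
            simp only [hgdef]; push_cast; ring
          rw [h6]
          calc (∏ n ∈ D.primeFactors, (1 + ((3 : ℕ) : ℝ) / n)) ^ 2
              ≤ (((D : ℝ) / Nat.totient D) ^ 3) ^ 2 :=
                pow_le_pow_left₀ (Finset.prod_nonneg fun n _ => by positivity) h5 2
            _ = ((D : ℝ) / Nat.totient D) ^ 6 := by ring
        calc ∏ q ∈ A.filter (fun q : Nat.Primes => (q : ℕ) ∣ D), ‖F q s‖
            ≤ ∏ n ∈ D.primeFactors, g n := h1.trans (h2 ▸ h3)
          _ ≤ ((D : ℝ) / Nat.totient D) ^ 6 := h4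
      -- the `q ∤ D` part: `≤ exp(2C'Z)`
      have hcop_part : ∏ q ∈ A.filter (fun q : Nat.Primes => ¬ (q : ℕ) ∣ D), ‖F q s‖ ≤ Cfin := by
        have h1 : ∏ q ∈ A.filter (fun q : Nat.Primes => ¬ (q : ℕ) ∣ D), ‖F q s‖ ≤
            ∏ q ∈ A.filter (fun q : Nat.Primes => ¬ (q : ℕ) ∣ D),
              (1 + 2 * C' * ((q : ℕ) : ℝ) ^ (-(17 / 10 : ℝ))) := by
          refine Finset.prod_le_prod (fun _ _ => norm_nonneg _) fun q hq => ?_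
          have hqD : ¬ (q : ℕ) ∣ D := (Finset.mem_filter.mp hq).2
          have hb := hcop q hqD s hsO
          calc ‖F q s‖ ≤ ‖F q s - 1‖ + ‖(1 : ℂ)‖ := by
                have := norm_add_le (F q s - 1) 1; rwa [sub_add_cancel] at this
            _ ≤ 2 * C' * ((q : ℕ) : ℝ) ^ (-(17 / 10 : ℝ)) + 1 := by rw [norm_one]; linarith
            _ = 1 + 2 * C' * ((q : ℕ) : ℝ) ^ (-(17 / 10 : ℝ)) := by ring
        have h2 := prod_one_add_le_exp_sum' (A.filter (fun q : Nat.Primes => ¬ (q : ℕ) ∣ D))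
          (fun q : Nat.Primes => 2 * C' * ((q : ℕ) : ℝ) ^ (-(17 / 10 : ℝ))) (fun q _ => by positivity)
        have h3 : ∑ q ∈ A.filter (fun q : Nat.Primes => ¬ (q : ℕ) ∣ D),
            2 * C' * ((q : ℕ) : ℝ) ^ (-(17 / 10 : ℝ)) ≤ 2 * C' * Z := by
          have h4 : ∑ q ∈ A.filter (fun q : Nat.Primes => ¬ (q : ℕ) ∣ D),
              2 * C' * ((q : ℕ) : ℝ) ^ (-(17 / 10 : ℝ)) ≤
              ∑' q : Nat.Primes, 2 * C' * ((q : ℕ) : ℝ) ^ (-(17 / 10 : ℝ)) :=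
            hb1sum.sum_le_tsum _ (fun q _ => by positivity)
          have h5 : ∑' q : Nat.Primes, 2 * C' * ((q : ℕ) : ℝ) ^ (-(17 / 10 : ℝ)) ≤ 2 * C' * Z := by
            have h6 : ∑' q : Nat.Primes, ((q : ℕ) : ℝ) ^ (-(17 / 10 : ℝ)) ≤ Z :=
              (hZsum.comp_injective Subtype.val_injective).tsum_le_tsum_of_inj
                (fun q : Nat.Primes => (q : ℕ)) Subtype.val_injective
                (fun n _ => Real.rpow_nonneg (Nat.cast_nonneg n) _) (fun q => le_rfl) hZsum
            rw [tsum_mul_left]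
            exact mul_le_mul_of_nonneg_left h6 (by positivity)
          exact h4.trans h5
        exact h1.trans (h2.trans ((Real.exp_le_exp.mpr h3).trans (le_of_eq hCfindef.symm)))
      have hnn1 : 0 ≤ ∏ q ∈ A.filter (fun q : Nat.Primes => ¬ (q : ℕ) ∣ D), ‖F q s‖ :=
        Finset.prod_nonneg fun _ _ => norm_nonneg _
      calc (∏ q ∈ A.filter (fun q : Nat.Primes => (q : ℕ) ∣ D), ‖F q s‖) *
            ∏ q ∈ A.filter (fun q : Nat.Primes => ¬ (q : ℕ) ∣ D), ‖F q s‖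
          ≤ ((D : ℝ) / Nat.totient D) ^ 6 * Cfin :=
            mul_le_mul hdvd_part hcop_part hnn1 (by positivity)
        _ = Cfin * ((D : ℝ) / Nat.totient D) ^ 6 := by ring
    -- `(D/φ(D))⁶ ≤ (2 log 𝓛)⁶ ≤ 𝓛`
    have hlog0 : 0 ≤ 2 * Real.log (ell D) := by
      have : 1 ≤ ell D := by linarith
      have := Real.log_nonneg this
      positivity
    have h6 : ((D : ℝ) / Nat.totient D) ^ 6 ≤ ell D :=
      (pow_le_pow_left₀ (le_trans zero_le_one hφ1) hφ 6).trans hpow6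
    exact hUB.trans (mul_le_mul_of_nonneg_left h6 (le_trans zero_le_one hCfin1))

end Literature.NumberTheory.LFunctions.Zhang2022.Typed.Section15C

end
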